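import Literature.MathematicalPhysics.QuantumFieldTheory.Balaban1983to89.B9Eq310TwistedBondDstarDZd
import Literature.MathematicalPhysics.QuantumFieldTheory.Balaban1983to89.B9Eq369CurvSmallZd

/-!
# `Balaban1983to89.B9Eq310TwistedBondDeltaPrimeZd` — [Balaban1985BackgroundPropagators] (3.10) p. 392 ON THE `ℤᵈ × 𝔸` CARRIER, AT ONE TWISTED BOND: the genuine
# curvature letter `Δ′(U₀)` (dag-n06-w2's object `DpZd` = the transported `B9Eq310Hermitian.deltaPrimeOp`) of the crossing-bond twist on the single-bond field —
# `(Δ′(U₀)δ_b h)(b) = (d−1)·(−4η⁻²)·h = −2·(D^{η*}_{U₀}D^η_{U₀}δ_b h)(b)`: on each of the `2(d−1)` plaquettes through `b` the weight `η⁻²(Re U(∂p) − 1) = −2η⁻²`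
# doubles and flips the principal part, and the commutator weight `η⁻² Im U(∂p)` vanishes

statement-level skeleton of published theorems with citation tags; proofs where landed; nothing here is a claim about the
Yang–Mills mass gap

`[Balaban1985BackgroundPropagators]` ("B9", CMP **99** (1985) 389–434): (3.10) p. 392 «⟨A,Δ′A⟩ = Σ_p η^d tr((D¹_U A)(p))² η⁻²(Re U(∂p) − 1) + tr Σ i[A′(b₁), A′(b₂)]η⁻²
Im U(∂p)» and «the operator Δ′ will be a bounded, small operator, which will be treated as a small perturbation of D*D» — small ONLY under (3.35): at a
plaquette variable `−1` (the maximum of `‖W − 1‖` on unitaries) the weight is `−2η⁻²` and `D*D + Δ′ = −D*D` there; (3.1)–(3.5) pp. 390–391, (3.9) p. 392,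
(3.69) p. 404.  PDF held: `paper:balaban1985-cmp99-background-propagators` p. 392.

CITATION HEADER ∕ WHY THIS FILE (cell `pub-ymgap`, HUMAN RULING D-0062 ∕ D-0149; width seat `pub-ymgap-dag-n06-w3` (g5), node N06 = [B9]; CLAIM-1 file 2∕3;
count-neutral).  The SIGN half of dag-n06-b g20's LOCATED-SELF-7 (see file 1's header): the mechanism is the second variation of the Wilson action at a
plaquette at its MAXIMUM, i.e. the (3.10) curvature letter.  THIS file evaluates the genuine `Δ′(U₀)` of the junction's record (`B9Eq369CurvSmallZd.DpZd`, the
(3.10) operator `deltaPrimeOp` of `B9Eq310Hermitian` transported by `shiftT ∕ byDir`) at the twisted bond on the test field of file 1, letter by letter through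
pv27's typed pieces `zP ∕ yP ∕ jordanF ∕ commG₁…₄ ∕ divP ∕ divL`: the four plaquette variables around `b` are `−1` (`plaqU_twist`), so `z(p) = −2η⁻²·1`,
`y(p) = 0` (`zP_yP_twist`), the Jordan term is `−2η⁻²` times the unit curl (`jordanF_twist`), the commutator letters vanish (`commG_twist`), and the plaquette
adjoint (3.9) collects `2(d−1)` equal contributions (`deltaPrimeOp_twist_single`).

WHAT IS PROVED (kernel, 0 sorry; theorems only).  `reC_neg_one` (`Re(−1) = −1`), `imC_neg_one` (`Im(−1) = 0`), `curl_single₁…₄` (the unit curls (3.4) of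
`δ_b h` around `b`: `±h`), ★ `plaqU_twist`, ★ `zP_yP_twist`, ★ `jordanF_twist`, `commG_twist`, ★★ `deltaPrimeOp_twist_single`
(`(Δ′(U₀)δ_b h)(b) = (d−1)·(2·(η⁻²·(−2)))·h` in the transported model), ★★ `DpZd_twist_single` (the same for the genuine letter `DpZd`, real scalars:
`(d−1)·(−4η⁻²)·h`).

HONEST SCOPE.  Finite non-commutative algebra on one explicit background and field (the (3.10) letters of pv27's `B9Eq310Hermitian`, transported by dag-n06-w2's
dictionary); no estimate of [B9]; count-neutral helper of K1⁹ (`--supports stmt-QuantumFields-27364`); N05 ∕ N06 NOT discharged; one finite `𝕋⁴` programme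
at fixed `ε`, Bałaban as printed; R4 closes only the conditional finite-`𝕋⁴` rung `BalabanLadder.UV` — nothing continuum ∕ `ℝ⁴` ∕ OS ∕ mass gap ∕ Clay.
Unit `pub-ymgap-dag-n06-w3` (g5), 2026-08-28.
-/

noncomputable section

open scoped BigOperators
open NormedSpace Complex

namespace Literature.MathematicalPhysics.QuantumFieldTheory.Balaban1983to89.B9Eq310TwistedBondDeltaPrimeZd

open B7Prop1Explicit (e)
open B7Prop2Explicit (unitaryUnits)
open B8Eq133Hypotheses (shiftT byDir byDir_apply)
open B9Eq37Insertion (reC imC)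
open B9Eq39Adjoint (R covD covDstar curl plaqU divP curl_swap R_one R_zero)
open B9Eq310Hermitian (zP yP jordanF sgnSum₁ sgnSum₂ sgnSum₃ sgnSum₄ commG₁ commG₂ commG₃ commG₄ divL deltaPrimeOp)
open B9Eq369CurvSmallZd (DpZd shiftT_symm_apply)
open B9Eq310TwistedBondDstarDZd

export B7Prop1Explicit (Site)

variable {d : ℕ}

section Letters

variable {𝔸 : Type*} [CStarAlgebra 𝔸]
variable (z : Site d) (ν : Fin d) (h : 𝔸) (η : ℝ)
variable {U₀ : Site d → Fin d → 𝔸ˣ} (hU : ∀ y κ, U₀ y κ = if y = z ∧ κ = ν then -1 else 1)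
variable {A : Site d → Fin d → 𝔸} (hA : ∀ y κ, A y κ = if y = z ∧ κ = ν then h else 0)



omit hU hA in
/-- `Re(−1) = −1` for the complexified real part of p. 391. [cite: Balaban1985BackgroundPropagators, p.391 («Re U(∂p) = ½(U(∂p) + U(−∂p))»)] -/
theorem reC_neg_one : reC (-1 : 𝔸ˣ) = -1 := by
  rw [reC, inv_neg_one, Units.val_neg, Units.val_one, ← two_smul ℂ (-1 : 𝔸), smul_smul, inv_mul_cancel₀ two_ne_zero, one_smul]

omit hU hA in
/-- `Im(−1) = 0`. [cite: Balaban1985BackgroundPropagators, p.391 («Im U(∂p) = (1/2i)(U(∂p) − U(−∂p))»)] -/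
theorem imC_neg_one : imC (-1 : 𝔸ˣ) = 0 := by
  rw [imC, inv_neg_one, sub_self, smul_zero]

include hU hA in
/-- `(D¹_{U₀}A)(p_{κν}(z − e_κ)) = h` in the transported model, `κ ≠ ν`. [cite: Balaban1985BackgroundPropagators, (3.4) p.391] -/
theorem curl_single₁ {κ : Fin d} (hκ : κ ≠ ν) : curl (shiftT d) (byDir U₀) (byDir A) κ ν (z - e κ) = h := by
  have h1 : A (z - e κ + e κ) ν = h := by rw [sub_add_cancel]; exact single_self z ν h hA
  have h2 : A (z - e κ) ν = 0 := single_of_site_ne z ν h hA (sub_e_ne_self z κ) ν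
  have h3 : A (z - e κ + e ν) κ = 0 := single_of_dir_ne z ν h hA _ hκ
  have h4 : A (z - e κ) κ = 0 := single_of_dir_ne z ν h hA _ hκ
  have hu : U₀ (z - e κ) κ = 1 := twist_of_dir_ne z ν hU _ hκ
  simp only [curl, covD, B8Eq133Hypotheses.shiftT_apply, byDir_apply, h1, h2, h3, h4, hu, R_one, R_zero, sub_zero]

include hA in
/-- `(D¹_{U₀}A)(p_{κν}(z)) = −h`, `κ ≠ ν`. [cite: Balaban1985BackgroundPropagators, (3.4) p.391] -/
theorem curl_single₂ {κ : Fin d} (hκ : κ ≠ ν) : curl (shiftT d) (byDir U₀) (byDir A) κ ν z = -h := by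
  have h1 : A (z + e κ) ν = 0 := single_of_site_ne z ν h hA (add_e_ne_self z κ) ν
  have h2 : A z ν = h := single_self z ν h hA
  have h3 : A (z + e ν) κ = 0 := single_of_dir_ne z ν h hA _ hκ
  have h4 : A z κ = 0 := single_of_dir_ne z ν h hA _ hκ
  simp only [curl, covD, B8Eq133Hypotheses.shiftT_apply, byDir_apply, h1, h2, h3, h4, R_zero, sub_zero, zero_sub]

include hU hA in
/-- `(D¹_{U₀}A)(p_{νκ}(z − e_κ)) = −h`, `κ ≠ ν`. [cite: Balaban1985BackgroundPropagators, (3.4) p.391, (3.5) p.391] -/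
theorem curl_single₃ {κ : Fin d} (hκ : κ ≠ ν) : curl (shiftT d) (byDir U₀) (byDir A) ν κ (z - e κ) = -h := by
  rw [curl_swap, curl_single₁ z ν h hU hA hκ]

include hA in
/-- `(D¹_{U₀}A)(p_{νκ}(z)) = h`, `κ ≠ ν`. [cite: Balaban1985BackgroundPropagators, (3.4) p.391, (3.5) p.391] -/
theorem curl_single₄ {κ : Fin d} (hκ : κ ≠ ν) : curl (shiftT d) (byDir U₀) (byDir A) ν κ z = h := by
  rw [curl_swap, curl_single₂ z ν h hA hκ, neg_neg]

omit hA in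
include hU in
/-- ★ the four plaquette variables around the twisted bond in the transported model are `−1`. [cite: Balaban1985BackgroundPropagators, (3.1) p.390] -/
theorem plaqU_twist {κ : Fin d} (hκ : κ ≠ ν) :
    plaqU (shiftT d) (byDir U₀) κ ν (z - e κ) = -1 ∧ plaqU (shiftT d) (byDir U₀) κ ν z = -1 ∧
      plaqU (shiftT d) (byDir U₀) ν κ (z - e κ) = -1 ∧ plaqU (shiftT d) (byDir U₀) ν κ z = -1 := by
  have h1 : ∀ y, U₀ y κ = 1 := fun y => twist_of_dir_ne z ν hU y hκ
  have h2 : U₀ (z - e κ + e κ) ν = -1 := by rw [sub_add_cancel]; exact twist_self z ν hU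
  have h3 : U₀ (z - e κ) ν = 1 := twist_of_site_ne z ν hU (sub_e_ne_self z κ) ν
  have h4 : U₀ z ν = -1 := twist_self z ν hU
  have h5 : U₀ (z + e κ) ν = 1 := twist_of_site_ne z ν hU (add_e_ne_self z κ) ν
  have hinv : (-1 : 𝔸ˣ)⁻¹ = -1 := inv_neg_one
  simp only [plaqU, B8Eq133Hypotheses.shiftT_apply, byDir_apply, h1, h2, h3, h4, h5, hinv, one_mul, mul_one, inv_one]
  exact ⟨trivial, trivial, trivial, trivial⟩

omit hA in
include hU in
/-- the (3.10) weights at the plaquettes through the twisted bond: `z(p) = η⁻²(Re(−1) − 1) = −2η⁻²·1`, `y(p) = η⁻² Im(−1) = 0`.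
[cite: Balaban1985BackgroundPropagators, (3.10) p.392] -/
theorem zP_yP_twist {κ : Fin d} (hκ : κ ≠ ν) :
    (zP (shiftT d) (byDir U₀) η κ ν (z - e κ) = ((((η : ℂ)⁻¹) ^ 2) * (-2)) • (1 : 𝔸) ∧
      zP (shiftT d) (byDir U₀) η κ ν z = ((((η : ℂ)⁻¹) ^ 2) * (-2)) • (1 : 𝔸) ∧
      zP (shiftT d) (byDir U₀) η ν κ (z - e κ) = ((((η : ℂ)⁻¹) ^ 2) * (-2)) • (1 : 𝔸) ∧
      zP (shiftT d) (byDir U₀) η ν κ z = ((((η : ℂ)⁻¹) ^ 2) * (-2)) • (1 : 𝔸)) ∧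
    (yP (shiftT d) (byDir U₀) η κ ν (z - e κ) = 0 ∧ yP (shiftT d) (byDir U₀) η κ ν z = 0 ∧
      yP (shiftT d) (byDir U₀) η ν κ (z - e κ) = 0 ∧ yP (shiftT d) (byDir U₀) η ν κ z = 0) := by
  obtain ⟨q1, q2, q3, q4⟩ := plaqU_twist z ν hU hκ
  have htwo : (-1 - 1 : 𝔸) = (-2 : ℂ) • (1 : 𝔸) := by rw [neg_smul, two_smul]; abel
  refine ⟨⟨?_, ?_, ?_, ?_⟩, ?_, ?_, ?_, ?_⟩
  all_goals first
    | (simp only [zP, q1, q2, q3, q4, reC_neg_one, htwo, smul_smul])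
    | (simp only [yP, q1, q2, q3, q4, imC_neg_one, smul_zero])

include hU hA in
/-- ★ the Jordan-symmetrised first term of (3.10) around the twisted bond: `F^J_A(p) = −2η⁻²·(D¹_{U₀}A)(p)` (the weight is central).
[cite: Balaban1985BackgroundPropagators, (3.10) p.392] -/
theorem jordanF_twist {κ : Fin d} (hκ : κ ≠ ν) :
    jordanF (shiftT d) (byDir U₀) η (byDir A) κ ν (z - e κ) = ((((η : ℂ)⁻¹) ^ 2) * (-2)) • h ∧
      jordanF (shiftT d) (byDir U₀) η (byDir A) κ ν z = -(((((η : ℂ)⁻¹) ^ 2) * (-2)) • h) ∧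
      jordanF (shiftT d) (byDir U₀) η (byDir A) ν κ (z - e κ) = -(((((η : ℂ)⁻¹) ^ 2) * (-2)) • h) ∧
      jordanF (shiftT d) (byDir U₀) η (byDir A) ν κ z = ((((η : ℂ)⁻¹) ^ 2) * (-2)) • h := by
  obtain ⟨⟨z1, z2, z3, z4⟩, -⟩ := zP_yP_twist z ν η hU hκ
  have key : ∀ (c : 𝔸) (t : ℂ), (2 : ℂ)⁻¹ • (c * (t • (1 : 𝔸)) + (t • (1 : 𝔸)) * c) = t • c := by
    intro c t
    rw [mul_smul_comm, mul_one, smul_mul_assoc, one_mul, ← two_smul ℂ (t • c), smul_smul, inv_mul_cancel₀ two_ne_zero, one_smul]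
  refine ⟨?_, ?_, ?_, ?_⟩
  · rw [jordanF, z1, curl_single₁ z ν h hU hA hκ, key]
  · rw [jordanF, z2, curl_single₂ z ν h hA hκ, key, smul_neg]
  · rw [jordanF, z3, curl_single₃ z ν h hU hA hκ, key, smul_neg]
  · rw [jordanF, z4, curl_single₄ z ν h hA hκ, key]

omit hA in
include hU in
/-- the commutator letters of (3.10) vanish around the twisted bond (`y(p) = 0`). [cite: Balaban1985BackgroundPropagators, (3.10) p.392] -/
theorem commG_twist (B : Fin d → Site d → 𝔸) {κ : Fin d} (hκ : κ ≠ ν) :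
    commG₄ (shiftT d) (byDir U₀) η B κ ν (z - e κ) = 0 ∧ commG₂ (shiftT d) (byDir U₀) η B κ ν z = 0 ∧
      commG₁ (shiftT d) (byDir U₀) η B ν κ (z - e κ) = 0 ∧ commG₃ (shiftT d) (byDir U₀) η B ν κ z = 0 := by
  obtain ⟨-, y1, y2, y3, y4⟩ := zP_yP_twist z ν η hU hκ
  simp only [commG₁, commG₂, commG₃, commG₄, y1, y2, y3, y4, zero_mul, mul_zero, sub_zero, smul_zero, and_self]

include hU hA in
/-- ★★ **THE `Δ′(U₀)` LETTER AT THE TWISTED BOND** in the transported (3.10) model: `(Δ′(U₀)δ_b h)(b) = (d−1)·(−4η⁻²)·h` — on each of the `2(d−1)` plaquettes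
through `b` the weight `Re U(∂p) − 1 = −2` doubles and flips the `D*D` contribution, the commutator weight `Im U(∂p)` vanishes.
[cite: Balaban1985BackgroundPropagators, (3.10) p.392, (3.9) p.392] -/
theorem deltaPrimeOp_twist_single :
    deltaPrimeOp (shiftT d) (byDir U₀) η (byDir A) ν z = ((d - 1 : ℕ) : ℂ) • (((2 : ℂ) * ((((η : ℂ)⁻¹) ^ 2) * (-2))) • h) := by
  classical
  set t : ℂ := (((η : ℂ)⁻¹) ^ 2) * (-2) with ht
  -- the `divP` part
  have hP : divP (shiftT d) (byDir U₀) (jordanF (shiftT d) (byDir U₀) η (byDir A)) ν z = ((d - 1 : ℕ) : ℂ) • (((2 : ℂ) * t) • h) := by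
    have hlt : ∀ κ : Fin d, (if κ < ν then covDstar (shiftT d) (byDir U₀) κ (jordanF (shiftT d) (byDir U₀) η (byDir A) κ ν) z else 0) =
        if κ < ν then ((2 : ℂ) * t) • h else 0 := by
      intro κ
      split_ifs with hκ
      · have hκ' : κ ≠ ν := hκ.ne
        obtain ⟨j1, j2, -, -⟩ := jordanF_twist z ν h η hU hA hκ'
        rw [covDstar, shiftT_symm_apply, byDir_apply, twist_of_dir_ne z ν hU _ hκ', inv_one, R_one, j1, j2]
        module
      · rfl
    have hgt : ∀ κ : Fin d, (if ν < κ then covDstar (shiftT d) (byDir U₀) κ (jordanF (shiftT d) (byDir U₀) η (byDir A) ν κ) z else 0) =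
        if ν < κ then -(((2 : ℂ) * t) • h) else 0 := by
      intro κ
      split_ifs with hκ
      · have hκ' : κ ≠ ν := hκ.ne'
        obtain ⟨-, -, j3, j4⟩ := jordanF_twist z ν h η hU hA hκ'
        rw [covDstar, shiftT_symm_apply, byDir_apply, twist_of_dir_ne z ν hU _ hκ', inv_one, R_one, j3, j4]
        module
      · rfl
    rw [divP, Finset.sum_congr rfl fun κ _ => hlt κ, Finset.sum_congr rfl fun κ _ => hgt κ, ← Finset.sum_filter, ← Finset.sum_filter,
      Finset.filter_gt_eq_Iio, Finset.filter_lt_eq_Ioi, Finset.sum_const, Finset.sum_const, smul_neg, sub_neg_eq_add, ← add_nsmul,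
      card_Iio_add_card_Ioi, ← Nat.cast_smul_eq_nsmul ℂ]
  -- the `divL` part vanishes
  have hL : divL (shiftT d) (byDir U₀) (commG₁ (shiftT d) (byDir U₀) η (byDir A)) (commG₂ (shiftT d) (byDir U₀) η (byDir A))
      (commG₃ (shiftT d) (byDir U₀) η (byDir A)) (commG₄ (shiftT d) (byDir U₀) η (byDir A)) ν z = 0 := by
    have hlt : ∀ κ : Fin d, (if κ < ν then R (byDir U₀ κ ((shiftT d κ).symm z))⁻¹ (commG₄ (shiftT d) (byDir U₀) η (byDir A) κ ν ((shiftT d κ).symm z)) -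
        commG₂ (shiftT d) (byDir U₀) η (byDir A) κ ν z else 0) = 0 := by
      intro κ
      split_ifs with hκ
      · obtain ⟨c4, c2, -, -⟩ := commG_twist z ν η hU (byDir A) hκ.ne
        rw [shiftT_symm_apply, c4, c2, R_zero, sub_zero]
      · rfl
    have hgt : ∀ κ : Fin d, (if ν < κ then R (byDir U₀ κ ((shiftT d κ).symm z))⁻¹ (commG₁ (shiftT d) (byDir U₀) η (byDir A) ν κ ((shiftT d κ).symm z)) -
        commG₃ (shiftT d) (byDir U₀) η (byDir A) ν κ z else 0) = 0 := by
      intro κ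
      split_ifs with hκ
      · obtain ⟨-, -, c1, c3⟩ := commG_twist z ν η hU (byDir A) hκ.ne'
        rw [shiftT_symm_apply, c1, c3, R_zero, sub_zero]
      · rfl
    rw [divL, Finset.sum_congr rfl fun κ _ => hlt κ, Finset.sum_congr rfl fun κ _ => hgt κ, Finset.sum_const_zero, sub_zero]
  rw [deltaPrimeOp, hP, hL, add_zero]

include hU hA in
/-- ★★ **THE GENUINE `Δ′(U₀)` (`DpZd`) AT THE TWISTED BOND**, real form: `(Δ′(U₀)δ_b h)(b) = (d−1)·(−4η⁻²)·h = −2·(D*Dδ_b h)(b)`.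
[cite: Balaban1985BackgroundPropagators, (3.10) p.392, (3.69) p.404] -/
theorem DpZd_twist_single : DpZd η U₀ A z ν = ((d - 1 : ℕ) : ℝ) • ((-4 * (η⁻¹ * η⁻¹)) • h) := by
  rw [B9Eq369CurvSmallZd.DpZd_apply, deltaPrimeOp_twist_single z ν h η hU hA, ← Complex.coe_smul (-4 * (η⁻¹ * η⁻¹)) h,
    Nat.cast_smul_eq_nsmul, Nat.cast_smul_eq_nsmul]
  congr 2
  push_cast
  ring


end Letters

end Literature.MathematicalPhysics.QuantumFieldTheory.Balaban1983to89.B9Eq310TwistedBondDeltaPrimeZd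

end
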